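import Literature.MathematicalPhysics.QuantumFieldTheory.Balaban1983to89.T3CruxEstimates
import Literature.MathematicalPhysics.QuantumFieldTheory.Balaban1983to89.T3HeightwiseDensityBounds
import HarnessLib

/-!
# Route `UnitScaleTilt` — crux `FluctuationComparisonRegPrIntL` (stmt-QuantumFields-20520): A.E. (FINITE) ADDITIVITY OF THE RESTRICTED
# RENORMALISED DENSITIES IN THE RESTRICTION EVENT — the decomposition of unity [Balaban1985UV3] (7) p.257 and the «sum of terms» (41) p.266
# read on the tree's `resDensity` ∕ `heightDensity` (support file, def-free; typed by ideator `ym-r3-idea-1` g23 per critic #461 P3 — HOME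
# `pub/ideators/ym-r3-idea-1/g23/FluctuationComparisonRegPrIntLRestrictedDensityAdditivity.lean` sha16 722d8ad6f38784d4 — and LANDED VERBATIM (theorem blocks byte-identical, this
# credit line added) by width seat `ym3-torus-px20` g12 as a `--supports stmt-QuantumFields-20520` helper, the ideator filing no Theorems by RULING №36)

WHAT THIS FILE PROVES (generic measure theory over the literature objects `T3RestrictedUnitDensity.resDensity F γ K S k` = the density of the
push-forward of `1_S·e^{−β_K A}·dU` under the `k`-fold (0.4) averaging, and `T3CruxEstimates.heightDensity F γ (n ≤ K) S` = the same at tower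
level `K − n` transported to height `n`):
* `setIntegral_resDensity_indicator` — `∫_A ρ^S_k = ∫ 1_{S ∩ (Ū^k)⁻¹A}·e^{−β_K A}` (indicator form; the set-integral form is the tree's
  ✓`FibrePositivity.setIntegral_resDensity_eq`, not imported here to keep this file OUT of the Theses cone — lint `theses-cone`);
* `resDensity_union_ae` — for DISJOINT measurable `S, S'`: `ρ^{S ∪ S'}_k = ρ^S_k + ρ^{S'}_k` a.e. ((7): the density of the whole is the sum of its terms);
* `resDensity_univ_ae_eq_add_compl` — `ρ_k = ρ^S_k + ρ^{Sᶜ}_k` a.e. (small-field term + all large-field terms);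
* `resDensity_empty_ae` — `ρ^∅_k = 0` a.e.;
* `resDensity_biUnion_ae` — for a `Finset` of pairwise disjoint measurable events: `ρ^{⋃ E_i}_k = Σ ρ^{E_i}_k` a.e. ((41)'s sum over histories, typed);
* the height-`n` readings `heightDensity_univ_ae_eq_add_compl'`, `heightDensity_biUnion_ae` (transport along the measure-preserving `fieldShift`).
MONOTONICITY in the event is NOT restated: it is the tree's ✓`LogComparisonSmallFieldRecursion.towerDensity_mono_ae` ∕ ✓`…OddsLedgerPregTop.heightDensity_mono_ae`.

HONEST: pure bookkeeping (Bochner-integral uniqueness of densities); nothing of Bałaban's analysis is asserted or proved; crux 20520, the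
stability letters and `YM3TorusSU2` are NOT proved here.

References: [Balaban1985UV3] T. Bałaban, Commun. Math. Phys. 102 (1985) 255–275, (2) p.256, (6)–(7) p.257, (41) p.266.
-/

noncomputable section

set_option autoImplicit false

open MeasureTheory Filter Topology Set
open scoped ENNReal NNReal
open Literature.MathematicalPhysics.QuantumFieldTheory.Balaban1983to89
open Literature.MathematicalPhysics.QuantumFieldTheory.Balaban1983to89.T3ContinuumYM3Torus
open Literature.MathematicalPhysics.QuantumFieldTheory.Balaban1983to89.T3LevelShift
open Literature.MathematicalPhysics.QuantumFieldTheory.Balaban1983to89.T3NestedUnitLaws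
open Literature.MathematicalPhysics.QuantumFieldTheory.Balaban1983to89.T3UnitLawDensityEML
open Literature.MathematicalPhysics.QuantumFieldTheory.Balaban1983to89.T3UnitScaleTilt
open Literature.MathematicalPhysics.QuantumFieldTheory.Balaban1983to89.T3RestrictedUnitDensity
open Literature.MathematicalPhysics.QuantumFieldTheory.Balaban1983to89.T3TiltDescent
open Literature.MathematicalPhysics.QuantumFieldTheory.Balaban1983to89.T3CruxEstimates
open Literature.MathematicalPhysics.QuantumFieldTheory.Balaban1983to89.T3HeightwiseDensityBounds
open Literature.MathematicalPhysics.QuantumFieldTheory.Balaban1983to89.Missing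
open Literature.MathematicalPhysics.QuantumFieldTheory.Balaban1983to89.T4Continuum
namespace Summit.QuantumFields.YangMills.Theorems.FluctuationComparisonRegPrIntLRestrictedDensityAdditivity

variable {F : T3Family} {γ : ℝ} {K : ℕ}

/-- `∫_A ρ^S_k dV_k = ∫ 1_{S ∩ (Ū^k)⁻¹A}·e^{−β_K A} dU` — (2)∕(6) with the test function `1_A` (indicator form; the set-integral form is the
tree's ✓`FibrePositivity.setIntegral_resDensity_eq`). [cite: Balaban1985UV3, (2) p.256 and (6) p.257] -/
theorem setIntegral_resDensity_indicator {S : Set (GaugeField (F.P K) 0 (Matrix.specialUnitaryGroup (Fin 2) ℂ))} (hS : MeasurableSet S)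
    (hγ : 0 ≤ γ) {k : ℕ} (hk : k ≤ F.m + K) {A : Set (GaugeField (F.P K) k (Matrix.specialUnitaryGroup (Fin 2) ℂ))}
    (hA : MeasurableSet A) :
    ∫ V in A, resDensity F γ K S k V ∂fieldMeasure (F.P K) k (Matrix.specialUnitaryGroup (Fin 2) ℂ) =
      ∫ U, (S ∩ Averaging.iter (fun i => BlockAveraging.blockAvg (P := F.P K) (j := i) ℰp) k ⁻¹' A).indicator
          (boltzmann (F.P K) ((F.scheme ℰp γ).β K)) U ∂fieldMeasure (F.P K) 0 (Matrix.specialUnitaryGroup (Fin 2) ℂ) := by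
  have hb : ∀ W : GaugeField (F.P K) k (Matrix.specialUnitaryGroup (Fin 2) ℂ), |A.indicator (fun _ => (1 : ℝ)) W| ≤ 1 :=
    fun W => by by_cases hW : W ∈ A <;> simp [hW]
  have key := integral_resDensity_mul F K hS hγ hk (A.indicator (fun _ => (1 : ℝ))) (measurable_const.indicator hA) ⟨1, hb⟩
  rw [← integral_indicator hA]
  have h1 : (fun V => A.indicator (resDensity F γ K S k) V) =
      fun V => resDensity F γ K S k V * A.indicator (fun _ => (1 : ℝ)) V := by
    funext V
    by_cases hV : V ∈ A <;> simp [hV]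
  rw [h1, key]
  refine integral_congr_ae (Eventually.of_forall fun U => ?_)
  by_cases hU : U ∈ S
  · by_cases hUA : Averaging.iter (fun i => BlockAveraging.blockAvg (P := F.P K) (j := i) ℰp) k U ∈ A
    · have hmem : U ∈ S ∩ Averaging.iter (fun i => BlockAveraging.blockAvg (P := F.P K) (j := i) ℰp) k ⁻¹' A := ⟨hU, hUA⟩
      simp [Set.indicator_of_mem hU, Set.indicator_of_mem hUA, Set.indicator_of_mem hmem]
    · have hnm : U ∉ S ∩ Averaging.iter (fun i => BlockAveraging.blockAvg (P := F.P K) (j := i) ℰp) k ⁻¹' A := fun h => hUA h.2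
      simp [Set.indicator_of_notMem hUA, Set.indicator_of_notMem hnm]
  · have hnm : U ∉ S ∩ Averaging.iter (fun i => BlockAveraging.blockAvg (P := F.P K) (j := i) ℰp) k ⁻¹' A := fun h => hU h.1
    simp [Set.indicator_of_notMem hU, Set.indicator_of_notMem hnm]

/-- The restricted Boltzmann weight on a measurable event is integrable against fine product Haar. [cite: Balaban1985UV3, (1) p.256] -/
theorem integrable_indicator_boltzmann (hγ : 0 ≤ γ) {E : Set (GaugeField (F.P K) 0 (Matrix.specialUnitaryGroup (Fin 2) ℂ))}
    (hE : MeasurableSet E) :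
    Integrable (E.indicator (boltzmann (F.P K) ((F.scheme ℰp γ).β K))) (fieldMeasure (F.P K) 0 (Matrix.specialUnitaryGroup (Fin 2) ℂ)) :=
  (integrable_boltzmann RegularGaugeGroup.measurable_reTr _ (F.scheme_β_nonneg ℰp hγ K)).indicator hE

/-- **A.E. ADDITIVITY OVER DISJOINT EVENTS**: `ρ^{S ∪ S'}_k = ρ^S_k + ρ^{S'}_k` for `dV_k`-almost every `V` (`S, S'` measurable, disjoint) —
the decomposition of unity (7) read on the renormalised densities. [cite: Balaban1985UV3, (7) p.257 and (2) p.256] -/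
theorem resDensity_union_ae {S S' : Set (GaugeField (F.P K) 0 (Matrix.specialUnitaryGroup (Fin 2) ℂ))} (hS : MeasurableSet S)
    (hS' : MeasurableSet S') (hd : Disjoint S S') (hγ : 0 ≤ γ) {k : ℕ} (hk : k ≤ F.m + K) :
    ∀ᵐ V ∂fieldMeasure (F.P K) k (Matrix.specialUnitaryGroup (Fin 2) ℂ),
      resDensity F γ K (S ∪ S') k V = resDensity F γ K S k V + resDensity F γ K S' k V := by
  have hint := integrable_resDensity F K (hS.union hS') hγ hk
  have hintS := integrable_resDensity F K hS hγ hk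
  have hintS' := integrable_resDensity F K hS' hγ hk
  have hmeas : Measurable (Averaging.iter (fun i => BlockAveraging.blockAvg (P := F.P K) (j := i) ℰp) k) :=
    measurable_iter _ (F.avgMeasurable_of_measurableE ℰp measurableE_ℰp K) k
  have h := Integrable.ae_eq_of_forall_setIntegral_eq _ _ hint (hintS.add hintS') fun A hA _ => by
    simp only [Pi.add_apply]
    rw [integral_add hintS.integrableOn hintS'.integrableOn, setIntegral_resDensity_indicator (hS.union hS') hγ hk hA,
      setIntegral_resDensity_indicator hS hγ hk hA, setIntegral_resDensity_indicator hS' hγ hk hA,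
      ← integral_add (integrable_indicator_boltzmann hγ (hS.inter (hA.preimage hmeas)))
        (integrable_indicator_boltzmann hγ (hS'.inter (hA.preimage hmeas)))]
    refine integral_congr_ae (Eventually.of_forall fun U => ?_)
    have hd' : Disjoint (S ∩ Averaging.iter (fun i => BlockAveraging.blockAvg (P := F.P K) (j := i) ℰp) k ⁻¹' A)
        (S' ∩ Averaging.iter (fun i => BlockAveraging.blockAvg (P := F.P K) (j := i) ℰp) k ⁻¹' A) :=
      hd.mono Set.inter_subset_left Set.inter_subset_left
    simp only [Set.union_inter_distrib_right, Set.indicator_union_of_disjoint hd']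
  filter_upwards [h] with V hV
  simpa using hV

/-- **THE STOPPED-FLOW SPLIT**: `ρ_k = ρ^S_k + ρ^{Sᶜ}_k` a.e., for every measurable event `S` of the fine field — with `S = histGood` this is
«density = small-field term + all large-field terms» of (7). [cite: Balaban1985UV3, (7) p.257] -/
theorem resDensity_univ_ae_eq_add_compl {S : Set (GaugeField (F.P K) 0 (Matrix.specialUnitaryGroup (Fin 2) ℂ))} (hS : MeasurableSet S)
    (hγ : 0 ≤ γ) {k : ℕ} (hk : k ≤ F.m + K) :
    ∀ᵐ V ∂fieldMeasure (F.P K) k (Matrix.specialUnitaryGroup (Fin 2) ℂ),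
      resDensity F γ K Set.univ k V = resDensity F γ K S k V + resDensity F γ K Sᶜ k V := by
  have h := resDensity_union_ae hS hS.compl disjoint_compl_right hγ hk
  rw [Set.union_compl_self] at h
  exact h

/-- `ρ^∅_k = 0` a.e. [cite: Balaban1985UV3, (2) p.256] -/
theorem resDensity_empty_ae (hγ : 0 ≤ γ) {k : ℕ} (hk : k ≤ F.m + K) :
    ∀ᵐ V ∂fieldMeasure (F.P K) k (Matrix.specialUnitaryGroup (Fin 2) ℂ),
      resDensity F γ K (∅ : Set (GaugeField (F.P K) 0 (Matrix.specialUnitaryGroup (Fin 2) ℂ))) k V = 0 := by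
  have h := resDensity_union_ae (F := F) (γ := γ) (K := K) MeasurableSet.empty
    (MeasurableSet.univ : MeasurableSet (Set.univ : Set (GaugeField (F.P K) 0 (Matrix.specialUnitaryGroup (Fin 2) ℂ))))
    disjoint_bot_left hγ hk
  rw [Set.empty_union] at h
  filter_upwards [h] with V hV
  linarith

/-- **FINITE ADDITIVITY OVER A PARTITION**: for a finite family of pairwise disjoint measurable events,
`ρ^{⋃_{i∈s} E_i}_k = Σ_{i∈s} ρ^{E_i}_k` a.e. — the expansion of (7) into the sum over histories (41), typed.
[cite: Balaban1985UV3, (7) p.257 and (41) p.266] -/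
theorem resDensity_biUnion_ae {ι : Type*} (s : Finset ι)
    {E : ι → Set (GaugeField (F.P K) 0 (Matrix.specialUnitaryGroup (Fin 2) ℂ))} (hE : ∀ i, MeasurableSet (E i))
    (hd : (↑s : Set ι).PairwiseDisjoint E) (hγ : 0 ≤ γ) {k : ℕ} (hk : k ≤ F.m + K) :
    ∀ᵐ V ∂fieldMeasure (F.P K) k (Matrix.specialUnitaryGroup (Fin 2) ℂ),
      resDensity F γ K (⋃ i ∈ s, E i) k V = ∑ i ∈ s, resDensity F γ K (E i) k V := by
  classical
  induction s using Finset.induction_on with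
  | empty =>
    have h0 : (⋃ i ∈ (∅ : Finset ι), E i) = ∅ := by simp
    rw [h0]
    filter_upwards [resDensity_empty_ae (F := F) (γ := γ) (K := K) hγ hk] with V hV
    simp [hV]
  | insert a s ha ih =>
    have hd' : (↑s : Set ι).PairwiseDisjoint E := hd.subset (by simp)
    have hdisj : Disjoint (E a) (⋃ i ∈ s, E i) := by
      rw [Set.disjoint_iUnion₂_right]
      intro i hi
      exact hd (by simp) (by simp [hi]) (fun h => ha (h ▸ hi))
    have hmeas : MeasurableSet (⋃ i ∈ s, E i) := Finset.measurableSet_biUnion s fun i _ => hE i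
    filter_upwards [resDensity_union_ae (F := F) (hE a) hmeas hdisj hγ hk, ih hd'] with V hV hih
    rw [Finset.set_biUnion_insert, hV, hih, Finset.sum_insert ha]

/-- **THE SPLIT AT THE COMPARISON HEIGHT**: `heightDensity univ = heightDensity S + heightDensity Sᶜ` `dU_n`-a.e. (transport of
`resDensity_univ_ae_eq_add_compl` along the measure-preserving level identification `fieldShift`). [cite: Balaban1985UV3, (7) p.257] -/
theorem heightDensity_univ_ae_eq_add_compl {n : ℕ} (hK : n ≤ K) {S : Set (GaugeField (F.P K) 0 (Matrix.specialUnitaryGroup (Fin 2) ℂ))}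
    (hS : MeasurableSet S) (hγ : 0 ≤ γ) :
    ∀ᵐ V ∂fieldMeasure (F.P n) 0 (Matrix.specialUnitaryGroup (Fin 2) ℂ),
      heightDensity F γ hK Set.univ V = heightDensity F γ hK S V + heightDensity F γ hK Sᶜ V := by
  have hae := resDensity_univ_ae_eq_add_compl (F := F) hS hγ (k := K - n) (by omega)
  have hmp := measurePreserving_fieldShift (G := Matrix.specialUnitaryGroup (Fin 2) ℂ)
    (F.sitesPerDir_eq (m := F.m) (K := K) (j := K - n) (m' := F.m) (K' := n) (j' := 0) (by omega))
  filter_upwards [hmp.quasiMeasurePreserving.ae hae] with V hV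
  exact hV

/-- FINITE ADDITIVITY AT THE COMPARISON HEIGHT. [cite: Balaban1985UV3, (7) p.257 and (41) p.266] -/
theorem heightDensity_biUnion_ae {n : ℕ} (hK : n ≤ K) {ι : Type*} (s : Finset ι)
    {E : ι → Set (GaugeField (F.P K) 0 (Matrix.specialUnitaryGroup (Fin 2) ℂ))} (hE : ∀ i, MeasurableSet (E i))
    (hd : (↑s : Set ι).PairwiseDisjoint E) (hγ : 0 ≤ γ) :
    ∀ᵐ V ∂fieldMeasure (F.P n) 0 (Matrix.specialUnitaryGroup (Fin 2) ℂ),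
      heightDensity F γ hK (⋃ i ∈ s, E i) V = ∑ i ∈ s, heightDensity F γ hK (E i) V := by
  have hae := resDensity_biUnion_ae (F := F) (γ := γ) (K := K) s hE hd hγ (k := K - n) (by omega)
  have hmp := measurePreserving_fieldShift (G := Matrix.specialUnitaryGroup (Fin 2) ℂ)
    (F.sitesPerDir_eq (m := F.m) (K := K) (j := K - n) (m' := F.m) (K' := n) (j' := 0) (by omega))
  filter_upwards [hmp.quasiMeasurePreserving.ae hae] with V hV
  exact hV

/-- FINITE ADDITIVITY AT THE COMPARISON HEIGHT over a finite index TYPE (every `i`), the form the history sum uses.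
[cite: Balaban1985UV3, (41) p.266] -/
theorem heightDensity_iUnion_fintype_ae {n : ℕ} (hK : n ≤ K) {ι : Type*} [Fintype ι]
    {E : ι → Set (GaugeField (F.P K) 0 (Matrix.specialUnitaryGroup (Fin 2) ℂ))} (hE : ∀ i, MeasurableSet (E i))
    (hd : Pairwise (fun i j => Disjoint (E i) (E j))) (hγ : 0 ≤ γ) :
    ∀ᵐ V ∂fieldMeasure (F.P n) 0 (Matrix.specialUnitaryGroup (Fin 2) ℂ),
      heightDensity F γ hK (⋃ i, E i) V = ∑ i, heightDensity F γ hK (E i) V := by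
  have hd' : (↑(Finset.univ : Finset ι) : Set ι).PairwiseDisjoint E := fun i _ j _ hij => hd hij
  have h := heightDensity_biUnion_ae (F := F) (γ := γ) hK Finset.univ hE hd' hγ
  have hU : (⋃ i ∈ (Finset.univ : Finset ι), E i) = ⋃ i, E i := by simp
  rw [hU] at h
  exact h

end Summit.QuantumFields.YangMills.Theorems.FluctuationComparisonRegPrIntLRestrictedDensityAdditivity

end
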